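import Summits.SmoothPoincare4.SmoothPoincare4.Theorems.SoloInformedPretzelSurgeryNineB

/-!
# `|π₁(S³₁₇(P(-2,3,7)))| = 2040`, unconditionally

The slope-17 surgery group `G17 = ⟨a₀,…,a₁₁ ∣ Wirtinger(P(-2,3,7)), μ¹⁷λ⟩` (PD-code presentation of
`SoloInformedPretzelSurgeryQuotients`) has order exactly `2040`, `ρ17 : G17 →* ℤ/17 × SL(2,𝔽₅)` is an
isomorphism, and all nine identities of `NineIdentities` hold — with no hypothesis.

Eight of the nine identities are kernel-certified van Kampen discs (`…ArcsA/B`, `…NineA/B`).  The ninth,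
`μ¹⁷ = yz⁻¹x`, is NOT certified by a disc; instead the order bound is obtained without it: with
`K = ψ(⟨2,3,5⟩) = ⟨x,y,z⟩` (order `≤ 120`, normalised by `μ` by `conjX/Y/Z`), every arc generator lies
in the coset `Kμ` (arc coincidences, `arc0`, `arc8`, two Wirtinger relations), hence the longitude word
of the surgery relator lies in `Kμ¹²` and the surgery relation `μ¹⁷·λ'·μ⁻¹² = 1` gives `μ¹⁷ ∈ K`
directly; the rest is the normal-form argument of `finite_and_card_of_nine`.  Then `|G17| ≤ 17·120`,
so `ρ17` (onto a group of order 2040) is bijective, and `pow17` follows from injectivity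
(`nine_of_injective`).  Solo programme `solo-SmoothPoincare4-informed`, s111.
-/

namespace Summit.SmoothPoincare4.SmoothPoincare4.Theorems
namespace PretzelSurgery

open Literature.Algebra.Homology.RelationModule

/-- The relators of `⟨2,3,5⟩` are killed by `x, y, z ∈ G17` (kernel-certified `relX/relY/relZ`). -/
theorem lift_icoGen' : ∀ r ∈ binaryTriangleRels 2 3 5, FreeGroup.lift icoGen r = 1 := by
  rintro r ⟨i, rfl⟩
  fin_cases i
  · simp only [powRelWord, xyzWord, triExp, map_mul, map_inv, map_pow, FreeGroup.lift_apply_of, icoGen]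
    simp only [Fin.zero_eta, Matrix.cons_val_zero, Matrix.cons_val_one, Matrix.cons_val, mul_inv_eq_one]
    exact relX_holds
  · simp only [powRelWord, xyzWord, triExp, map_mul, map_inv, map_pow, FreeGroup.lift_apply_of, icoGen]
    simp only [Matrix.cons_val_zero, Fin.mk_one, Matrix.cons_val_one, Matrix.cons_val, mul_inv_eq_one]
    exact relY_holds
  · simp only [powRelWord, xyzWord, triExp, map_mul, map_inv, map_pow, FreeGroup.lift_apply_of, icoGen]
    simp only [Matrix.cons_val_zero, Matrix.cons_val_one, Matrix.cons_val, Fin.reduceFinMk, mul_inv_eq_one]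
    exact relZ_holds

/-- `ψ : ⟨2,3,5⟩ →* G17`, unconditionally. -/
def psi : B235 →* G17 := PresentedGroup.toGroup lift_icoGen'

/-- `ψ` on generators. -/
theorem psi_of (i : Fin 3) : psi (PresentedGroup.of i) = icoGen i := by unfold psi; exact PresentedGroup.toGroup.of _

/-- The surgery relation in the form `μ¹⁷ · λ' · (μ¹²)⁻¹ = 1`, `λ' = a₀a₆a₄a₂a₀a₁₁a₇a₁a₇a₅a₃a₈`. -/
theorem surgery_pow : mu9 ^ 17 * (g17 0 * g17 6 * g17 4 * g17 2 * g17 0 * g17 11 * g17 7 * g17 1 * g17 7 *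
    g17 5 * g17 3 * g17 8) * (mu9 ^ 12)⁻¹ = 1 := by
  have h := t17_w12
  simp only [pow_succ, pow_zero, one_mul, mul_inv_rev, mu9, mul_assoc] at h ⊢
  exact h

/-- **Main theorem (unconditional).** `G17` is finite of order at most `2040`. -/
theorem finite_and_card_le : Finite G17 ∧ Nat.card G17 ≤ 2040 := by
  -- `K = ψ(⟨2,3,5⟩) ∋ x, y, z`, finite of order `≤ 120`
  set K : Subgroup G17 := psi.range with hKdef
  have hx : xI ∈ K := ⟨PresentedGroup.of 0, psi_of 0⟩
  have hy : yI ∈ K := ⟨PresentedGroup.of 1, psi_of 1⟩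
  have hz : zI ∈ K := ⟨PresentedGroup.of 2, psi_of 2⟩
  haveI : Finite B235 := BinaryIcosahedralOrder.finite
  haveI hKfin : Finite K := Finite.of_surjective _ psi.rangeRestrict_surjective
  have hKcard : Nat.card K ≤ 120 :=
    (Nat.card_le_card_of_surjective _ psi.rangeRestrict_surjective).trans BinaryIcosahedralOrder.card_le
  -- `μ K μ⁻¹ ≤ K`
  have hconj : ∀ k ∈ K, mu9 * k * mu9⁻¹ ∈ K := by
    have hgen : ∀ i : Fin 3, (PresentedGroup.of i : B235) ∈ K.comap ((MulAut.conj mu9).toMonoidHom.comp psi) := by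
      intro i
      simp only [Subgroup.mem_comap, MonoidHom.coe_comp, MulEquiv.coe_toMonoidHom, Function.comp_apply,
        MulAut.conj_apply, psi_of, icoGen]
      fin_cases i
      · simp only [Fin.zero_eta, Matrix.cons_val_zero, conjX_holds]
        exact K.mul_mem (K.mul_mem hy hx) (K.inv_mem hy)
      · simp only [Fin.mk_one, Matrix.cons_val_one, Matrix.cons_val_zero, conjY_holds]
        exact K.mul_mem (K.mul_mem (K.mul_mem hx hz) (K.inv_mem hy)) (K.inv_mem hz)
      · simp only [Fin.reduceFinMk, Matrix.cons_val, conjZ_holds]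
        exact K.mul_mem hy (K.inv_mem hz)
    rintro k ⟨b, rfl⟩
    have hb := PresentedGroup.generated_by _ _ hgen b
    simpa only [Subgroup.mem_comap, MonoidHom.coe_comp, MulEquiv.coe_toMonoidHom, Function.comp_apply,
      MulAut.conj_apply] using hb
  have hconj_pow : ∀ n : ℕ, ∀ k ∈ K, mu9 ^ n * k * (mu9 ^ n)⁻¹ ∈ K := by
    intro n
    induction n with
    | zero => intro k hk; simpa using hk
    | succ n ih =>
      intro k hk
      have e : mu9 ^ (n + 1) * k * (mu9 ^ (n + 1))⁻¹ = mu9 * (mu9 ^ n * k * (mu9 ^ n)⁻¹) * mu9⁻¹ := by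
        rw [pow_succ']; group
      rw [e]; exact hconj _ (ih k hk)
  -- every arc generator lies in the coset `K μ`
  have q9 : g17 9 * mu9⁻¹ ∈ K := by rw [mu9, mul_inv_cancel]; exact K.one_mem
  have q3 : g17 3 * mu9⁻¹ ∈ K := by rw [g17_3_eq_9]; exact q9
  have q6 : g17 6 * mu9⁻¹ ∈ K := by rw [g17_6_eq_9]; exact q9
  have q0 : g17 0 * mu9⁻¹ ∈ K := by rw [arc0_holds, mul_inv_cancel_right]; exact hy
  have q8 : g17 8 * mu9⁻¹ ∈ K := by
    rw [arc8_holds, mul_inv_cancel_right]; exact K.mul_mem (K.mul_mem hx (K.inv_mem hy)) (K.inv_mem hz)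
  have q7 : g17 7 * mu9⁻¹ ∈ K := by rw [g17_7_eq_8]; exact q8
  have q4 : g17 4 * mu9⁻¹ ∈ K := by rw [g17_4_eq_7]; exact q7
  have q2 : g17 2 * mu9⁻¹ ∈ K := by
    have e : g17 2 * mu9⁻¹ = zI * (g17 4 * mu9⁻¹) := by rw [zI]; group
    rw [e]; exact K.mul_mem hz q4
  have q5 : g17 5 * mu9⁻¹ ∈ K := by rw [← g17_2_eq_5]; exact q2
  have q11 : g17 11 * mu9⁻¹ ∈ K := by rw [← g17_5_eq_11]; exact q5
  have q10 : g17 10 * mu9⁻¹ ∈ K := by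
    -- `a₁₀ = a₇ a₀ a₇⁻¹` (Wirtinger `t17_w1`)
    have e1 : g17 10 = g17 7 * g17 0 * (g17 7)⁻¹ := by
      have h := t17_w1
      rw [mul_inv_eq_one] at h
      rw [← h]; group
    have e : g17 10 * mu9⁻¹ = (g17 7 * mu9⁻¹) * (mu9 * ((g17 0 * mu9⁻¹) * (g17 7 * mu9⁻¹)⁻¹) * mu9⁻¹) := by
      rw [e1]; group
    rw [e]; exact K.mul_mem q7 (hconj _ (K.mul_mem q0 (K.inv_mem q7)))
  have q1 : g17 1 * mu9⁻¹ ∈ K := by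
    -- `a₁ = a₁₁ a₁₀ a₁₁⁻¹` (Wirtinger `t17_w11`)
    have e1 : g17 1 = g17 11 * g17 10 * (g17 11)⁻¹ := by
      have h := t17_w11
      rw [mul_inv_eq_one] at h
      rw [← h]; group
    have e : g17 1 * mu9⁻¹ = (g17 11 * mu9⁻¹) * (mu9 * ((g17 10 * mu9⁻¹) * (g17 11 * mu9⁻¹)⁻¹) * mu9⁻¹) := by
      rw [e1]; group
    rw [e]; exact K.mul_mem q11 (hconj _ (K.mul_mem q10 (K.inv_mem q11)))
  -- hence the longitude word lies in `K μ¹²`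
  have stepQ : ∀ (m : ℕ) (u a : G17), u * (mu9 ^ m)⁻¹ ∈ K → a * mu9⁻¹ ∈ K → u * a * (mu9 ^ (m + 1))⁻¹ ∈ K := by
    intro m u a hu ha
    have e : u * a * (mu9 ^ (m + 1))⁻¹ = (u * (mu9 ^ m)⁻¹) * (mu9 ^ m * (a * mu9⁻¹) * (mu9 ^ m)⁻¹) := by
      rw [pow_succ]; group
    rw [e]; exact K.mul_mem hu (hconj_pow m _ ha)
  have hL : g17 0 * g17 6 * g17 4 * g17 2 * g17 0 * g17 11 * g17 7 * g17 1 * g17 7 * g17 5 * g17 3 * g17 8 *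
      (mu9 ^ 12)⁻¹ ∈ K := by
    have s1 : g17 0 * (mu9 ^ 1)⁻¹ ∈ K := by rw [pow_one]; exact q0
    exact stepQ 11 _ _ (stepQ 10 _ _ (stepQ 9 _ _ (stepQ 8 _ _ (stepQ 7 _ _ (stepQ 6 _ _ (stepQ 5 _ _
      (stepQ 4 _ _ (stepQ 3 _ _ (stepQ 2 _ _ (stepQ 1 _ _ s1 q6) q4) q2) q0) q11) q7) q1) q7) q5) q3) q8
  -- and the surgery relation gives `μ¹⁷ ∈ K`
  have h17 : mu9 ^ 17 ∈ K := by
    have e : mu9 ^ 17 = (g17 0 * g17 6 * g17 4 * g17 2 * g17 0 * g17 11 * g17 7 * g17 1 * g17 7 * g17 5 * g17 3 *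
        g17 8 * (mu9 ^ 12)⁻¹)⁻¹ := by
      rw [eq_inv_iff_mul_eq_one, ← surgery_pow]; group
    rw [e]; exact K.inv_mem hL
  -- `μ⁻¹ K μ ≤ K`, using `μ⁻¹ = μ¹⁶ (μ¹⁷)⁻¹`
  have hconj' : ∀ k ∈ K, mu9⁻¹ * k * mu9 ∈ K := by
    intro k hk
    have e : mu9⁻¹ * k * mu9 = mu9 ^ 16 * ((mu9 ^ 17)⁻¹ * k * mu9 ^ 17) * (mu9 ^ 16)⁻¹ := by group
    rw [e]; exact hconj_pow 16 _ (K.mul_mem (K.mul_mem (K.inv_mem h17) hk) h17)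
  have hconj'_pow : ∀ n : ℕ, ∀ k ∈ K, (mu9 ^ n)⁻¹ * k * mu9 ^ n ∈ K := by
    intro n
    induction n with
    | zero => intro k hk; simpa using hk
    | succ n ih =>
      intro k hk
      have e : (mu9 ^ (n + 1))⁻¹ * k * mu9 ^ (n + 1) = mu9⁻¹ * ((mu9 ^ n)⁻¹ * k * mu9 ^ n) * mu9 := by
        rw [pow_succ]; group
      rw [e]; exact hconj' _ (ih k hk)
  -- the normal form `μⁿ k`
  let P : G17 → Prop := fun g => ∃ n : ℕ, ∃ k ∈ K, g = mu9 ^ n * k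
  have P1 : P 1 := ⟨0, 1, K.one_mem, by simp⟩
  have Pmu9 : ∀ g, P g → P (mu9 * g) := by
    rintro g ⟨n, k, hk, rfl⟩; exact ⟨n + 1, k, hk, by rw [pow_succ']; group⟩
  have Pmu9' : ∀ g, P g → P (mu9⁻¹ * g) := by
    rintro g ⟨n, k, hk, rfl⟩
    refine ⟨n + 16, (mu9 ^ 17)⁻¹ * k, K.mul_mem (K.inv_mem h17) hk, ?_⟩
    rw [pow_add]; group
  have PK : ∀ k' ∈ K, ∀ g, P g → P (k' * g) := by
    rintro k' hk' g ⟨n, k, hk, rfl⟩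
    refine ⟨n, (mu9 ^ n)⁻¹ * k' * mu9 ^ n * k, K.mul_mem (hconj'_pow n k' hk') hk, ?_⟩
    group
  have PKinv : ∀ k' ∈ K, ∀ g, P g → P (k'⁻¹ * g) := fun k' hk' g hg => PK _ (K.inv_mem hk') g hg
  have hw8 : xI * yI⁻¹ * zI⁻¹ ∈ K := K.mul_mem (K.mul_mem hx (K.inv_mem hy)) (K.inv_mem hz)
  have Pall : ∀ g ∈ Subgroup.closure ({g17 0, g17 8, g17 9} : Set G17), P g := by
    intro g hg
    refine Subgroup.closure_induction_left (p := fun g _ => P g) P1 ?_ ?_ hg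
    · rintro a ha g - hPg
      simp only [Set.mem_insert_iff, Set.mem_singleton_iff] at ha
      rcases ha with rfl | rfl | rfl
      · rw [arc0_holds, mul_assoc]; exact PK _ hy _ (Pmu9 _ hPg)
      · rw [arc8_holds, mul_assoc]; exact PK _ hw8 _ (Pmu9 _ hPg)
      · exact Pmu9 _ hPg
    · rintro a ha g - hPg
      simp only [Set.mem_insert_iff, Set.mem_singleton_iff] at ha
      rcases ha with rfl | rfl | rfl
      · rw [arc0_holds, mul_inv_rev, mul_assoc]; exact Pmu9' _ (PKinv _ hy _ hPg)
      · rw [arc8_holds, mul_inv_rev, mul_assoc]; exact Pmu9' _ (PKinv _ hw8 _ hPg)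
      · exact Pmu9' _ hPg
  have htop : ∀ g : G17, g ∈ Subgroup.closure ({g17 0, g17 8, g17 9} : Set G17) := by
    intro g
    obtain ⟨b, rfl⟩ := σ17_surjective g
    have hgen : ∀ i : Fin 3, (PresentedGroup.of i : G17c) ∈
        (Subgroup.closure ({g17 0, g17 8, g17 9} : Set G17)).comap σ17 := by
      intro i
      rw [Subgroup.mem_comap, show σ17 (PresentedGroup.of i) = kept17 i from PresentedGroup.toGroup.of _]
      apply Subgroup.subset_closure
      fin_cases i <;> simp [kept17]
    exact PresentedGroup.generated_by _ _ hgen b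
  let f : Fin 17 × K → G17 := fun p => mu9 ^ (p.1 : ℕ) * p.2
  have hf : Function.Surjective f := by
    intro g
    obtain ⟨n, k, hk, rfl⟩ := Pall g (htop g)
    refine ⟨(⟨n % 17, Nat.mod_lt _ (by norm_num)⟩, ⟨(mu9 ^ 17) ^ (n / 17) * k, K.mul_mem (K.pow_mem h17 _) hk⟩), ?_⟩
    show mu9 ^ (n % 17) * ((mu9 ^ 17) ^ (n / 17) * k) = mu9 ^ n * k
    rw [← mul_assoc, ← pow_mul, ← pow_add, Nat.mod_add_div]
  haveI : Finite G17 := Finite.of_surjective f hf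
  refine ⟨inferInstance, ?_⟩
  calc Nat.card G17 ≤ Nat.card (Fin 17 × K) := Nat.card_le_card_of_surjective f hf
    _ = 17 * Nat.card K := by rw [Nat.card_prod, Nat.card_eq_fintype_card, Fintype.card_fin]
    _ ≤ 17 * 120 := Nat.mul_le_mul_left _ hKcard

/-- **UNCONDITIONAL: `|π₁(S³₁₇(P(-2,3,7)))| = |G17| = 2040` and `ρ17` is an isomorphism.** -/
theorem card_G17_and_bijective : Nat.card G17 = 2040 ∧ Function.Bijective ρ17 := by
  obtain ⟨hfin, hle⟩ := finite_and_card_le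
  haveI := hfin
  exact ⟨le_antisymm hle le_card_G17, bijective_ρ17_of_card_le hle⟩

/-- `Nat.card G17 = 2040`. -/
theorem card_G17 : Nat.card G17 = 2040 := card_G17_and_bijective.1

/-- `ρ17 : G17 →* ℤ/17 × SL(2,𝔽₅)` is bijective. -/
theorem bijective_ρ17 : Function.Bijective ρ17 := card_G17_and_bijective.2

/-- `G17` is finite. -/
theorem finite_G17 : Finite G17 := finite_and_card_le.1

/-- The isomorphism `G17 ≃* ℤ/17 × SL(2,𝔽₅)`. -/
noncomputable def mulEquivK17 : G17 ≃* K17 := MulEquiv.ofBijective ρ17 bijective_ρ17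

/-- All nine identities hold in `G17` (eight by disc certificates, `pow17` via injectivity of `ρ17`). -/
theorem nineIdentities : NineIdentities := nine_of_injective bijective_ρ17.1

/-- `μ¹⁷ = yz⁻¹x` in `G17`. -/
theorem pow17_holds : mu9 ^ 17 = yI * zI⁻¹ * xI := nineIdentities.pow17

end PretzelSurgery
end Summit.SmoothPoincare4.SmoothPoincare4.Theorems
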